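import Mathlib
import HarnessLib
import Summits.Ventures.LatticeQCDFlow.Scaling.AnnealingCostSandwich
import Literature.Analysis.Complex.DeBruijnUniversalFactorsProofs

/-!
# LatticeQCDFlow / Scaling — the VARIANCE-FLOOR LAYER LAW: protocol-free necessity (v2.5)

HONEST FRAMING: exact (Metropolis-corrected) sampling algorithms for lattice gauge theory; figures
of merit are autocorrelation/cost numbers at stated couplings and volumes; no continuum-physics
claim.

Venture `LatticeQCDFlow` (cell pub-lqcd), topic `Scaling`, FANOUT row 29 (theory2) — OUR WORK
(THEORY-2.md v2.5 §3.5 (x) / §4 row C3).  Nothing here is a cited result.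

Items 29–31 bound the cost of PERFECTLY RELAXED annealing along the UNIFORM protocol from both
sides by mean-action drops.  This file removes the protocol: for ANY coupling protocol
`β_0, β_1, …, β_n` with endpoints `β_0`, `β_n` (`Δ := β_n − β_0`) on a single-site exponential
family `p_β ∝ e^{−βA}`,

* the symmetrised moment-generating-function bound
  `E_π[e^{tY}]·E_π[e^{−tY}] = Σ_x Σ_y π(x)π(y)·cosh(t(Y x − Y y)) ≥ 1 + t²·Var_π(Y)`
  (`mgf_mul_mgf_neg_ge`, from `cosh u ≥ 1 + u²/2`), hence the VARIANCE STEP BOUND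
  `ESS(p_{β+h}, p_β) ≤ 1/(1 + h²·Var_{β+h}(A))` (`essFrac_expFamily_le_inv_var`);
* a variance floor `Var_{β_k}(A) ≥ v` at the protocol points gives, by `Π(1 + y_k) ≥ 1 + Σ y_k`
  and Cauchy–Schwarz `Σ_k h_k² ≥ Δ²/n`, the protocol-free bound
  `Π_k ESS_k ≤ 1/(1 + v·Δ²/n)` (`prod_essFrac_le_inv_varFloor`), and on `m` independent sites
  with perfect relaxation `ÊSS ≤ (1 + vΔ²/n)^{−m}` (`perfectRelaxation_sites_varFloor`);
* corollaries: fewer than `v·Δ²` layers force `ÊSS ≤ 2^{−m}` (`ess_sites_le_of_few_layers`), and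
  in the regime `v·Δ² ≤ n`, `ÊSS ≥ ε` forces `n·log(1/ε) ≥ m·v·Δ²/2` (`layers_necessary_of_ess`)
  — the NECESSITY counterpart, for every protocol, of the sufficiency count
  `n ≥ m·Δ·(b − a)/log(1/ε)` of item 31.
-/

noncomputable section

namespace Summit.Ventures.LatticeQCDFlow.Theory2

open Finset Summit.Ventures.LatticeQCDFlow.Exactness

variable {X : Type*} [Fintype X]

/-! ## Two elementary inequalities -/

/-- `1 + Σ_k y_k ≤ Π_k (1 + y_k)` for `y_k ≥ 0`. [folklore] -/
theorem one_add_sum_le_prod_fin :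
    ∀ (n : ℕ) (y : Fin n → ℝ), (∀ k, 0 ≤ y k) → 1 + ∑ k, y k ≤ ∏ k, (1 + y k)
  | 0, y, _ => by simp
  | n + 1, y, hy => by
      rw [Fin.sum_univ_castSucc, Fin.prod_univ_castSucc]
      have ih := one_add_sum_le_prod_fin n (fun k => y k.castSucc) fun k => hy _
      have hP : 1 ≤ ∏ k : Fin n, (1 + y k.castSucc) :=
        le_trans (le_add_of_nonneg_right (sum_nonneg fun k _ => hy (Fin.castSucc k))) ih
      have ha := hy (Fin.last n)
      nlinarith [mul_le_mul_of_nonneg_left hP ha, ih]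

/-! ## The symmetrised product of moment generating functions -/

/-- **`E_π[e^{tY}]·E_π[e^{−tY}] ≥ 1 + (t²/2)·Σ_x Σ_y π(x)π(y)(Y x − Y y)²`** for a probability
vector `π`: the product is the double sum `Σ_x Σ_y π(x)π(y)·cosh(t(Y x − Y y))`, and
`cosh u ≥ 1 + u²/2`.
[folklore] -/
theorem mgf_mul_mgf_neg_ge (π Y : X → ℝ) (hπ : ∀ x, 0 ≤ π x) (hπ1 : ∑ x, π x = 1) (t : ℝ) :
    1 + t ^ 2 / 2 * ∑ x, ∑ y, π x * π y * (Y x - Y y) ^ 2 ≤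
      (∑ x, π x * Real.exp (t * Y x)) * ∑ x, π x * Real.exp (-(t * Y x)) := by
  have hprod : (∑ x, π x * Real.exp (t * Y x)) * (∑ x, π x * Real.exp (-(t * Y x))) =
      ∑ x, ∑ y, π x * π y * Real.exp (t * (Y x - Y y)) := by
    rw [sum_mul_sum]
    refine sum_congr rfl fun x _ => sum_congr rfl fun y _ => ?_
    rw [mul_sub, sub_eq_add_neg, Real.exp_add]
    ring
  have hsymm : ∑ x, ∑ y, π x * π y * Real.exp (t * (Y x - Y y)) =
      ∑ x, ∑ y, π x * π y * Real.exp (t * (Y y - Y x)) := by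
    rw [sum_comm]
    exact sum_congr rfl fun x _ => sum_congr rfl fun y _ => by ring
  have hcosh : ∑ x, ∑ y, π x * π y * Real.cosh (t * (Y x - Y y)) =
      (∑ x, π x * Real.exp (t * Y x)) * ∑ x, π x * Real.exp (-(t * Y x)) := by
    have hc : ∀ x y, π x * π y * Real.cosh (t * (Y x - Y y)) =
        (π x * π y * Real.exp (t * (Y x - Y y)) + π x * π y * Real.exp (t * (Y y - Y x))) / 2 := by
      intro x y
      rw [Real.cosh_eq, show -(t * (Y x - Y y)) = t * (Y y - Y x) by ring]
      ring
    simp_rw [hc, ← sum_div, sum_add_distrib]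
    rw [← hsymm, ← hprod]
    ring
  have h1 : ∑ x, ∑ y, π x * π y * (1 + (t * (Y x - Y y)) ^ 2 / 2) ≤
      ∑ x, ∑ y, π x * π y * Real.cosh (t * (Y x - Y y)) :=
    sum_le_sum fun x _ => sum_le_sum fun y _ =>
      mul_le_mul_of_nonneg_left (Literature.Analysis.Complex.DeBruijn1950.one_add_sq_div_two_le_cosh _) (mul_nonneg (hπ x) (hπ y))
  have h0 : ∑ x, ∑ y, π x * π y * (1 + (t * (Y x - Y y)) ^ 2 / 2) =
      1 + t ^ 2 / 2 * ∑ x, ∑ y, π x * π y * (Y x - Y y) ^ 2 := by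
    have hc : ∀ x, ∑ y, π x * π y * (1 + (t * (Y x - Y y)) ^ 2 / 2) =
        π x * ∑ y, π y + t ^ 2 / 2 * ∑ y, π x * π y * (Y x - Y y) ^ 2 := by
      intro x
      rw [mul_sum, mul_sum, ← sum_add_distrib]
      exact sum_congr rfl fun y _ => by ring
    simp_rw [hc, hπ1, mul_one]
    rw [sum_add_distrib, hπ1, ← mul_sum]
  rw [← h0, ← hcosh]
  exact h1

/-- The double sum is twice the variance:
`Σ_x Σ_y π(x)π(y)(Y x − Y y)² = 2·Σ_x π(x)(Y x − μ)²`, `μ = Σ π Y` (`Σ π = 1`). [folklore] -/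
theorem sum_sum_sq_sub_eq (π Y : X → ℝ) (hπ1 : ∑ x, π x = 1) :
    ∑ x, ∑ y, π x * π y * (Y x - Y y) ^ 2 =
      2 * ∑ x, π x * (Y x - ∑ y, π y * Y y) ^ 2 := by
  have hL : ∑ x, ∑ y, π x * π y * (Y x - Y y) ^ 2 =
      2 * ∑ x, π x * Y x ^ 2 - 2 * (∑ x, π x * Y x) ^ 2 := by
    have hc : ∀ x, ∑ y, π x * π y * (Y x - Y y) ^ 2 =
        π x * Y x ^ 2 * ∑ y, π y - 2 * (π x * Y x) * ∑ y, π y * Y y +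
          π x * ∑ y, π y * Y y ^ 2 := by
      intro x
      rw [mul_sum, mul_sum, mul_sum, ← sum_sub_distrib, ← sum_add_distrib]
      exact sum_congr rfl fun y _ => by ring
    simp_rw [hc, hπ1, mul_one]
    rw [sum_add_distrib, sum_sub_distrib, ← sum_mul, ← sum_mul, hπ1, one_mul, ← mul_sum]
    ring
  have hR : ∑ x, π x * (Y x - ∑ y, π y * Y y) ^ 2 =
      ∑ x, π x * Y x ^ 2 - (∑ x, π x * Y x) ^ 2 := by
    have hc : ∀ x, π x * (Y x - ∑ y, π y * Y y) ^ 2 =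
        π x * Y x ^ 2 - 2 * (∑ y, π y * Y y) * (π x * Y x) +
          (∑ y, π y * Y y) ^ 2 * π x := fun x => by ring
    simp_rw [hc]
    rw [sum_add_distrib, sum_sub_distrib, ← mul_sum, ← mul_sum, hπ1]
    ring
  rw [hL, hR]
  ring

/-! ## The variance step bound for exponential families -/

section ExpFamily

variable [Nonempty X]

/-- The variance of `A` under `p_β ∝ e^{−βA}`: `Var_β(A) = Σ_x p_β(x)(A x − ⟨A⟩_β)²`. -/
def varObs (A : X → ℝ) (β : ℝ) : ℝ :=
  ∑ x, gibbsLaw (fun x => β * A x) x * (A x - meanObs A β) ^ 2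

/-- `Var_β(A) ≥ 0`. [folklore] -/
theorem varObs_nonneg (A : X → ℝ) (β : ℝ) : 0 ≤ varObs A β :=
  sum_nonneg fun x _ => mul_nonneg (gibbsLaw_pos _ x).le (sq_nonneg _)

/-- **THE VARIANCE STEP BOUND: `ESS(p_{β+h}, p_β) ≤ 1/(1 + h²·Var_{β+h}(A))`** — one annealing
step of size `h` against a target whose action variance is `Var` costs at least
`log(1 + h²·Var)` in `−log ESS`, for ANY finite exponential family (no boundedness, no sign of
`h`).  From `1/ESS = E_{β+h}[e^{hA}]·E_{β+h}[e^{−hA}]` (item 29) and `mgf_mul_mgf_neg_ge`.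
[folklore] -/
theorem essFrac_expFamily_le_inv_var (A : X → ℝ) (β h : ℝ) :
    essFrac (gibbsLaw fun x => (β + h) * A x) (gibbsLaw fun x => β * A x) ≤
      (1 + h ^ 2 * varObs A (β + h))⁻¹ := by
  rw [essFrac_expFamily_eq_inv]
  have hπ : ∀ x, 0 ≤ gibbsLaw (fun x => (β + h) * A x) x := fun x => (gibbsLaw_pos _ x).le
  have hπ1 := sum_gibbsLaw (fun x => (β + h) * A x)
  have hge := mgf_mul_mgf_neg_ge (gibbsLaw fun x => (β + h) * A x) A hπ hπ1 h
  rw [sum_sum_sq_sub_eq _ _ hπ1] at hge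
  have hpos : 0 < 1 + h ^ 2 * varObs A (β + h) := by
    have := varObs_nonneg A (β + h)
    positivity
  refine inv_anti₀ hpos ?_
  have hv : h ^ 2 / 2 * (2 * ∑ x, gibbsLaw (fun x => (β + h) * A x) x *
      (A x - ∑ y, gibbsLaw (fun x => (β + h) * A x) y * A y) ^ 2) =
      h ^ 2 * varObs A (β + h) := by
    simp only [varObs, meanObs]
    ring
  linarith

/-- A variance FLOOR `0 ≤ v ≤ Var_{β+h}(A)` turns the step bound into
`ESS(p_{β+h}, p_β) ≤ 1/(1 + v·h²)`. [folklore] -/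
theorem essFrac_expFamily_le_inv_floor (A : X → ℝ) (β h : ℝ) {v : ℝ} (hv0 : 0 ≤ v)
    (hv : v ≤ varObs A (β + h)) :
    essFrac (gibbsLaw fun x => (β + h) * A x) (gibbsLaw fun x => β * A x) ≤ (1 + v * h ^ 2)⁻¹ := by
  refine le_trans (essFrac_expFamily_le_inv_var A β h) (inv_anti₀ (by positivity) ?_)
  nlinarith [mul_le_mul_of_nonneg_right hv (sq_nonneg h)]

end ExpFamily

/-! ## Protocol-free product bound -/

section Protocol

variable [Nonempty X] {n : ℕ}

/-- The steps of a protocol telescope: `Σ_k (β_{k+1} − β_k) = β_n − β_0`. [folklore] -/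
theorem sum_steps_eq (β : Fin (n + 1) → ℝ) :
    ∑ k : Fin n, (β k.succ - β k.castSucc) = β (Fin.last n) - β 0 := by
  have h1 := Fin.sum_univ_succ β
  have h2 := Fin.sum_univ_castSucc β
  rw [sum_sub_distrib]
  linarith

/-- Cauchy–Schwarz for the steps: `Σ_k (β_{k+1} − β_k)² ≥ (β_n − β_0)²/n` (`n ≥ 1`). [folklore] -/
theorem sum_steps_sq_ge (β : Fin (n + 1) → ℝ) (hn : 0 < n) :
    (β (Fin.last n) - β 0) ^ 2 / n ≤ ∑ k : Fin n, (β k.succ - β k.castSucc) ^ 2 := by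
  have hn' : (0 : ℝ) < n := by exact_mod_cast hn
  rw [div_le_iff₀ hn', ← sum_steps_eq β]
  have := sq_sum_le_card_mul_sum_sq (s := (univ : Finset (Fin n)))
    (f := fun k => β k.succ - β k.castSucc)
  rw [card_univ, Fintype.card_fin] at this
  linarith

/-- **PROTOCOL-FREE PRODUCT BOUND.**  For ANY protocol `β_0, …, β_n` (`n ≥ 1`) on the family
`p_β ∝ e^{−βA}` with a variance floor `Var_{β_k}(A) ≥ v ≥ 0` at the protocol points
`k = 1, …, n`:  `Π_k ESS(p_{β_{k+1}}, p_{β_k}) ≤ 1/(1 + v·(β_n − β_0)²/n)`. [folklore] -/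
theorem prod_essFrac_le_inv_varFloor (A : X → ℝ) (β : Fin (n + 1) → ℝ) {v : ℝ} (hv0 : 0 ≤ v)
    (hv : ∀ k : Fin n, v ≤ varObs A (β k.succ)) (hn : 0 < n) :
    ∏ k : Fin n, essFrac (gibbsLaw fun x => β k.succ * A x)
        (gibbsLaw fun x => β k.castSucc * A x) ≤
      (1 + v * (β (Fin.last n) - β 0) ^ 2 / n)⁻¹ := by
  have hstep : ∀ k : Fin n, essFrac (gibbsLaw fun x => β k.succ * A x)
      (gibbsLaw fun x => β k.castSucc * A x) ≤
        (1 + v * (β k.succ - β k.castSucc) ^ 2)⁻¹ := by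
    intro k
    have h := essFrac_expFamily_le_inv_floor A (β k.castSucc) (β k.succ - β k.castSucc)
      hv0 (by rw [add_sub_cancel]; exact hv k)
    rwa [add_sub_cancel] at h
  have hy : ∀ k : Fin n, 0 ≤ v * (β k.succ - β k.castSucc) ^ 2 := fun k => by positivity
  calc ∏ k : Fin n, essFrac (gibbsLaw fun x => β k.succ * A x)
        (gibbsLaw fun x => β k.castSucc * A x)
      ≤ ∏ k : Fin n, (1 + v * (β k.succ - β k.castSucc) ^ 2)⁻¹ :=
        prod_le_prod (fun k _ => essFrac_nonneg fun x => (gibbsLaw_pos _ x).le) fun k _ => hstep k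
    _ = (∏ k : Fin n, (1 + v * (β k.succ - β k.castSucc) ^ 2))⁻¹ := prod_inv_distrib _
    _ ≤ (1 + ∑ k : Fin n, v * (β k.succ - β k.castSucc) ^ 2)⁻¹ :=
        inv_anti₀ (by have := sum_nonneg fun k (_ : k ∈ univ) => hy k; positivity)
          (one_add_sum_le_prod_fin n _ hy)
    _ ≤ (1 + v * (β (Fin.last n) - β 0) ^ 2 / n)⁻¹ := by
        refine inv_anti₀ (by positivity) ?_
        rw [← mul_sum, mul_div_assoc]
        have := sum_steps_sq_ge β hn
        nlinarith

end Protocol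

/-! ## On `m` independent sites with perfect relaxation -/

section Sites

variable {Z : Type*} [LinearOrder Z] [Fintype Z] [Nonempty Z] {m n : ℕ}

/-- **THE VARIANCE-FLOOR LAYER LAW (proved, protocol-free).**  `m` independent sites,
single-site family `∝ e^{−βA}`, ANY protocol `β_0, …, β_n` (`n ≥ 1`), every layer resampling its
target exactly, variance floor `Var_{β_k}(A) ≥ v ≥ 0` at the protocol points:
`ÊSS ≤ (1 + v·(β_n − β_0)²/n)^{−m}`.  [folklore] -/
theorem perfectRelaxation_sites_varFloor (m : ℕ) (A : Z → ℝ) (β : Fin (n + 1) → ℝ) {v : ℝ}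
    (hv0 : 0 ≤ v) (hv : ∀ k : Fin n, v ≤ varObs A (β k.succ)) (hn : 0 < n) :
    essFrac
        (revPathLaw (siteSum m A β) fun k _ ψ => gibbsLaw (siteSum m A β k.succ) ψ)
        (pathLaw (gibbsLaw (siteSum m A β 0)) fun k _ ψ => gibbsLaw (siteSum m A β k.succ) ψ) ≤
      ((1 + v * (β (Fin.last n) - β 0) ^ 2 / n) ^ m)⁻¹ := by
  rw [ess_perfect_relaxation_sites, ← inv_pow]
  exact pow_le_pow_left₀
    (prod_nonneg fun k _ => essFrac_nonneg fun x => (gibbsLaw_pos _ x).le)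
    (prod_essFrac_le_inv_varFloor A β hv0 hv hn) m

/-- **Few layers kill the ESS exponentially in the volume:** with `n ≤ v·(β_n − β_0)²` layers,
`ÊSS ≤ 2^{−m}`. [folklore] -/
theorem ess_sites_le_of_few_layers (m : ℕ) (A : Z → ℝ) (β : Fin (n + 1) → ℝ) {v : ℝ}
    (hv0 : 0 ≤ v) (hv : ∀ k : Fin n, v ≤ varObs A (β k.succ)) (hn : 0 < n)
    (hfew : (n : ℝ) ≤ v * (β (Fin.last n) - β 0) ^ 2) :
    essFrac
        (revPathLaw (siteSum m A β) fun k _ ψ => gibbsLaw (siteSum m A β k.succ) ψ)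
        (pathLaw (gibbsLaw (siteSum m A β 0)) fun k _ ψ => gibbsLaw (siteSum m A β k.succ) ψ) ≤
      ((2 : ℝ) ^ m)⁻¹ := by
  refine le_trans (perfectRelaxation_sites_varFloor m A β hv0 hv hn) (inv_anti₀ (by positivity) ?_)
  have hn' : (0 : ℝ) < n := by exact_mod_cast hn
  refine pow_le_pow_left₀ (by norm_num) ?_ m
  linarith [(one_le_div hn').2 hfew]

/-- **NECESSITY OF `Θ(m·v·Δ²)` LAYERS (proved, every protocol).**  In the regime
`v·Δ² ≤ n` (`Δ = β_n − β_0`), `ÊSS ≥ ε > 0` forces `n·log(1/ε) ≥ m·v·Δ²/2`; compare the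
sufficiency count `n ≥ m·Δ·(b − a)/log(1/ε)` of `ess_sites_ge_of_layers` (item 31).
[folklore] -/
theorem layers_necessary_of_ess (m : ℕ) (A : Z → ℝ) (β : Fin (n + 1) → ℝ) {v ε : ℝ}
    (hv0 : 0 ≤ v) (hv : ∀ k : Fin n, v ≤ varObs A (β k.succ)) (hn : 0 < n)
    (hreg : v * (β (Fin.last n) - β 0) ^ 2 ≤ n) (hε0 : 0 < ε)
    (hε : ε ≤ essFrac
        (revPathLaw (siteSum m A β) fun k _ ψ => gibbsLaw (siteSum m A β k.succ) ψ)
        (pathLaw (gibbsLaw (siteSum m A β 0)) fun k _ ψ => gibbsLaw (siteSum m A β k.succ) ψ)) :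
    (m : ℝ) * (v * (β (Fin.last n) - β 0) ^ 2) / 2 ≤ n * Real.log (1 / ε) := by
  have hn' : (0 : ℝ) < n := by exact_mod_cast hn
  set x : ℝ := v * (β (Fin.last n) - β 0) ^ 2 / n with hx
  have hx0 : 0 ≤ x := by positivity
  have hx1 : x ≤ 1 := (div_le_one hn').2 hreg
  have h1 : ε ≤ ((1 + x) ^ m)⁻¹ := le_trans hε (perfectRelaxation_sites_varFloor m A β hv0 hv hn)
  -- logarithms: log ε ≤ −m·log(1+x)
  have hlog : Real.log ε ≤ -(m * Real.log (1 + x)) := by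
    have := Real.log_le_log hε0 h1
    rwa [Real.log_inv, Real.log_pow] at this
  -- log(1+x) ≥ x/2 on [0,1]
  have hlx : x / 2 ≤ Real.log (1 + x) := by
    have h2 : x / 2 ≤ x / (1 + x) := div_le_div_of_nonneg_left hx0 (by positivity) (by linarith)
    have h3 : x / (1 + x) = 1 - (1 + x)⁻¹ := by
      field_simp
      ring
    have h4 := Real.one_sub_inv_le_log_of_pos (show (0 : ℝ) < 1 + x by positivity)
    linarith
  have hle : (m : ℝ) * (x / 2) ≤ Real.log (1 / ε) := by
    rw [one_div, Real.log_inv]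
    have := mul_le_mul_of_nonneg_left hlx (Nat.cast_nonneg m)
    linarith
  have := mul_le_mul_of_nonneg_left hle hn'.le
  calc (m : ℝ) * (v * (β (Fin.last n) - β 0) ^ 2) / 2 = (n : ℝ) * (m * (x / 2)) := by
        rw [hx]; field_simp
    _ ≤ n * Real.log (1 / ε) := this

end Sites

end Summit.Ventures.LatticeQCDFlow.Theory2

end
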